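import Literature.Analysis.OperatorTheory.GaussianTransferKernel
import Mathlib.MeasureTheory.Measure.Haar.InnerProductSpace
import Mathlib.Analysis.InnerProductSpace.Spectrum
import HarnessLib

/-!
# The anisotropic harmonic transfer kernel in an orthonormal frame / for a symmetric positive Hessian: Gaussian ground state
# and sharp form bound by NORMAL MODES

Source: A. Wipf, *Statistical Approach to Quantum Field Theory* (2nd ed., Springer LNP 992, 2021), §8.5.1 eqs. (8.54)–(8.58) (the
harmonic transfer kernel and its Gaussian ground state, one degree of freedom) and §8.5.2 eqs. (8.64)–(8.67) (the free lattice field: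
«the transfer matrix … is a product of commuting one-mode transfer matrices» after diagonalising the quadratic form by normal modes)
[held: `book:wipf2021-statistical-approach-quantum-field-theory-introduction` p0179 ff.].

The tree file `GaussianTransferKernel.lean` proves the ground-state identity and the sharp Schur bound for the ISOTROPIC kernel
`e^{−a‖x‖²}e^{−b‖x−y‖²}e^{−a‖y‖²}` on an inner-product space and for the DIAGONAL anisotropic kernel on `ι → ℝ`.  Applications (the stiff
modes of a lattice gauge theory around a background: Hessian = a symmetric positive semi-definite operator `A` which is NOT diagonal in the
link coordinates) need the same statements for the kernel

  `K_A(x,y) = e^{−⟪x,Ax⟫} e^{−b‖x−y‖²} e^{−⟪y,Ay⟫}`   on a finite-dimensional real inner-product space `V` (its canonical Lebesgue measure).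

This file transports the diagonal statements along an orthonormal frame (every such frame is a volume-preserving identification
`V ≃ (ι → ℝ)`), and then specialises to the eigenframe of a symmetric operator (finite-dimensional spectral theorem, Mathlib
`LinearMap.IsSymmetric.eigenvectorBasis`):

* `integral_gaussKernel_mul_groundState_frame` — for an orthonormal basis `e` and weights `aᵢ ≥ 0`, `cᵢ ≥ 0`, `cᵢ² = aᵢ² + 2aᵢb`, `b > 0`:
  `∫ e^{−Σaᵢ⟪eᵢ,x⟫²} e^{−b‖x−y‖²} e^{−Σaᵢ⟪eᵢ,y⟫²} e^{−Σcᵢ⟪eᵢ,y⟫²} dy = (Πᵢ √(π/(aᵢ+b+cᵢ))) e^{−Σcᵢ⟪eᵢ,x⟫²}`;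
* `integral_integral_mul_gaussKernel_mul_self_le_frame` — the sharp form bound `∫∫ f(x) K f(y) ≤ (Πᵢ √(π/(aᵢ+b+cᵢ))) ∫ f²` in a frame;
* `inner_self_apply_eq_sum_eigenvalues` — `⟪x, Ax⟫ = Σᵢ aᵢ ⟪eᵢ, x⟫²` in the eigenframe of a symmetric `A` (`aᵢ` its eigenvalues), so that
  `integral_gaussKernel_mul_groundState_symm` / `integral_integral_mul_gaussKernel_mul_self_le_symm` — the NORMAL-MODE form: for a symmetric
  operator `A` with non-negative eigenvalues the kernel `K_A` has the Gaussian ground state `e^{−Σcᵢ⟪eᵢ,x⟫²}` (`eᵢ` the eigenframe,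
  `cᵢ = √(aᵢ²+2aᵢb)`) with eigenvalue `Πᵢ √(π/(aᵢ+b+cᵢ))`, which bounds its quadratic form.

No definitions, no named facts, 0 sorry.
-- TODO(general form): kernels `e^{−⟪x,Px⟫ + 2⟪x,Ry⟫ − ⟪y,Py⟫}` with non-commuting `P`, `R` (discrete algebraic Riccati equation).
-/

noncomputable section

open MeasureTheory Real
open scoped RealInnerProductSpace

namespace Literature.Analysis.OperatorTheory.GaussianTransferKernel

variable {V : Type*} [NormedAddCommGroup V] [InnerProductSpace ℝ V] [FiniteDimensional ℝ V]
  [MeasurableSpace V] [BorelSpace V]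
variable {ι : Type*} [Fintype ι]

/-! ## §1 Coordinates in an orthonormal frame: a volume-preserving identification `V ≃ᵐ (ι → ℝ)` -/

/-- The coordinate map of an orthonormal frame as a measurable equivalence `V ≃ᵐ (ι → ℝ)`. [folklore] -/
private theorem exists_coord (e : OrthonormalBasis ι ℝ V) :
    ∃ Ψ : V ≃ᵐ (ι → ℝ), MeasurePreserving Ψ volume volume ∧ ∀ x i, Ψ x i = ⟪e i, x⟫ := by
  refine ⟨e.measurableEquiv.trans (MeasurableEquiv.toLp 2 (ι → ℝ)).symm,
    (e.measurePreserving_measurableEquiv).trans (EuclideanSpace.volume_preserving_symm_measurableEquiv_toLp ι), fun x i => ?_⟩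
  simp only [MeasurableEquiv.trans_apply]
  show (MeasurableEquiv.toLp 2 (ι → ℝ)).symm (e.repr x) i = ⟪e i, x⟫
  rw [← e.repr_apply_apply]
  rfl

omit [FiniteDimensional ℝ V] [MeasurableSpace V] [BorelSpace V] in
/-- `‖x − y‖² = Σᵢ (⟪eᵢ,x⟫ − ⟪eᵢ,y⟫)²` (Parseval in the frame). [folklore] -/
private theorem norm_sub_sq_eq_sum (e : OrthonormalBasis ι ℝ V) (x y : V) :
    ‖x - y‖ ^ 2 = ∑ i, (⟪e i, x⟫ - ⟪e i, y⟫) ^ 2 := by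
  rw [← e.sum_sq_inner_right (x - y)]
  simp only [inner_sub_right]

/-! ## §2 The Gaussian ground state in a frame -/

/-- **Gaussian ground state of the anisotropic harmonic kernel in an orthonormal frame**: for `aᵢ ≥ 0`, `b > 0`, `cᵢ ≥ 0`,
`cᵢ² = aᵢ² + 2aᵢb`: `∫ e^{−Σaᵢ⟪eᵢ,x⟫²} e^{−b‖x−y‖²} e^{−Σaᵢ⟪eᵢ,y⟫²} e^{−Σcᵢ⟪eᵢ,y⟫²} dy = (Πᵢ √(π/(aᵢ+b+cᵢ))) · e^{−Σcᵢ⟪eᵢ,x⟫²}`.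
[cite: Wipf2021, §8.5.1 (8.56)–(8.57)] -/
theorem integral_gaussKernel_mul_groundState_frame (e : OrthonormalBasis ι ℝ V) {a c : ι → ℝ} {b : ℝ} (ha : ∀ i, 0 ≤ a i)
    (hb : 0 < b) (hc0 : ∀ i, 0 ≤ c i) (hc : ∀ i, c i ^ 2 = a i ^ 2 + 2 * a i * b) (x : V) :
    ∫ y, Real.exp (-(∑ i, a i * ⟪e i, x⟫ ^ 2)) * Real.exp (-(b * ‖x - y‖ ^ 2)) *
        Real.exp (-(∑ i, a i * ⟪e i, y⟫ ^ 2)) * Real.exp (-(∑ i, c i * ⟪e i, y⟫ ^ 2)) =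
      (∏ i, Real.sqrt (π / (a i + b + c i))) * Real.exp (-(∑ i, c i * ⟪e i, x⟫ ^ 2)) := by
  obtain ⟨Ψ, hΨ, hΨe⟩ := exists_coord e
  set G : (ι → ℝ) → (ι → ℝ) → ℝ := fun x' y' =>
    Real.exp (-(∑ i, a i * x' i ^ 2)) * Real.exp (-(b * ∑ i, (x' i - y' i) ^ 2)) *
      Real.exp (-(∑ i, a i * y' i ^ 2)) * Real.exp (-(∑ i, c i * y' i ^ 2)) with hG
  have hpt : ∀ y, Real.exp (-(∑ i, a i * ⟪e i, x⟫ ^ 2)) * Real.exp (-(b * ‖x - y‖ ^ 2)) *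
      Real.exp (-(∑ i, a i * ⟪e i, y⟫ ^ 2)) * Real.exp (-(∑ i, c i * ⟪e i, y⟫ ^ 2)) = G (Ψ x) (Ψ y) := fun y => by
    simp only [hG, hΨe, norm_sub_sq_eq_sum e x y]
  simp_rw [hpt]
  rw [hΨ.integral_comp Ψ.measurableEmbedding (g := fun y' => G (Ψ x) y')]
  rw [hG, integral_gaussKernel_mul_groundState_pi ha hb hc0 hc (Ψ x)]
  simp only [hΨe]

/-! ## §3 The sharp form bound in a frame -/

/-- **Sharp form bound in an orthonormal frame**: `∫∫ f(x) e^{−Σaᵢ⟪eᵢ,x⟫²} e^{−b‖x−y‖²} e^{−Σaᵢ⟪eᵢ,y⟫²} f(y) dy dx ≤ (Πᵢ √(π/(aᵢ+b+cᵢ))) ∫ f²`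
for `f` with `f²` integrable (`aᵢ ≥ 0`, `b > 0`, `cᵢ ≥ 0`, `cᵢ² = aᵢ² + 2aᵢb`). [cite: Wipf2021, §8.5.1 (8.56)–(8.58)] -/
theorem integral_integral_mul_gaussKernel_mul_self_le_frame (e : OrthonormalBasis ι ℝ V) {a c : ι → ℝ} {b : ℝ}
    (ha : ∀ i, 0 ≤ a i) (hb : 0 < b) (hc0 : ∀ i, 0 ≤ c i) (hc : ∀ i, c i ^ 2 = a i ^ 2 + 2 * a i * b) {f : V → ℝ}
    (hf : Integrable (fun x => f x ^ 2)) (hfm : AEStronglyMeasurable f volume) :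
    ∫ x, ∫ y, f x * (Real.exp (-(∑ i, a i * ⟪e i, x⟫ ^ 2)) * Real.exp (-(b * ‖x - y‖ ^ 2)) *
        Real.exp (-(∑ i, a i * ⟪e i, y⟫ ^ 2))) * f y ≤
      (∏ i, Real.sqrt (π / (a i + b + c i))) * ∫ x, f x ^ 2 := by
  obtain ⟨Ψ, hΨ, hΨe⟩ := exists_coord e
  set K' : (ι → ℝ) → (ι → ℝ) → ℝ := fun x' y' =>
    Real.exp (-(∑ i, a i * x' i ^ 2)) * Real.exp (-(b * ∑ i, (x' i - y' i) ^ 2)) * Real.exp (-(∑ i, a i * y' i ^ 2)) with hK'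
  set g : (ι → ℝ) → ℝ := fun x' => f (Ψ.symm x') with hg
  have hgf : ∀ x, g (Ψ x) = f x := fun x => by simp only [hg, MeasurableEquiv.symm_apply_apply]
  -- transport the hypotheses
  have hΨs : MeasurePreserving Ψ.symm volume volume := hΨ.symm Ψ
  have hg2 : Integrable (fun x' => g x' ^ 2) := by
    have := (hΨs.integrable_comp_emb Ψ.symm.measurableEmbedding).2 hf
    simpa only [hg, Function.comp_def] using this
  have hgm : AEStronglyMeasurable g volume := by
    have hfm' : AEStronglyMeasurable f (Measure.map Ψ.symm volume) := by rw [hΨs.map_eq]; exact hfm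
    exact hfm'.comp_measurable Ψ.symm.measurable
  -- the pointwise transport of the integrand
  have hpt : ∀ x y, f x * (Real.exp (-(∑ i, a i * ⟪e i, x⟫ ^ 2)) * Real.exp (-(b * ‖x - y‖ ^ 2)) *
      Real.exp (-(∑ i, a i * ⟪e i, y⟫ ^ 2))) * f y = g (Ψ x) * K' (Ψ x) (Ψ y) * g (Ψ y) := fun x y => by
    simp only [hK', hΨe, norm_sub_sq_eq_sum e x y, hgf]
  simp_rw [hpt]
  have hinner : ∀ x, ∫ y, g (Ψ x) * K' (Ψ x) (Ψ y) * g (Ψ y) = ∫ y', g (Ψ x) * K' (Ψ x) y' * g y' := fun x =>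
    hΨ.integral_comp Ψ.measurableEmbedding (g := fun y' => g (Ψ x) * K' (Ψ x) y' * g y')
  simp_rw [hinner]
  rw [hΨ.integral_comp Ψ.measurableEmbedding (g := fun x' => ∫ y', g x' * K' x' y' * g y')]
  have hsq : ∫ x, f x ^ 2 = ∫ x', g x' ^ 2 := by
    rw [← hΨ.integral_comp Ψ.measurableEmbedding (g := fun x' => g x' ^ 2)]
    simp only [hgf]
  rw [hsq, hK']
  exact integral_integral_mul_gaussKernel_mul_self_le_pi ha hb hc0 hc hg2 hgm

/-! ## §4 Normal modes: the kernel `e^{−⟪x,Ax⟫} e^{−b‖x−y‖²} e^{−⟪y,Ay⟫}` for a symmetric operator `A` with non-negative spectrum -/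

section Symm

variable {n : ℕ} {A : V →ₗ[ℝ] V}

omit [MeasurableSpace V] [BorelSpace V] in
/-- In the eigenframe `eᵢ` of a symmetric operator `A` (eigenvalues `aᵢ`): `⟪x, A x⟫ = Σᵢ aᵢ ⟪eᵢ, x⟫²` (finite-dimensional spectral
theorem, quadratic-form version). [cite: HornJohnson2013, Thm 4.1.5] -/
theorem inner_self_apply_eq_sum_eigenvalues (hA : A.IsSymmetric) (hn : Module.finrank ℝ V = n) (x : V) :
    ⟪x, A x⟫ = ∑ i, hA.eigenvalues hn i * ⟪hA.eigenvectorBasis hn i, x⟫ ^ 2 := by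
  set e := hA.eigenvectorBasis hn with he
  have hx : A x = ∑ i, (hA.eigenvalues hn i * ⟪e i, x⟫) • e i := by
    conv_lhs => rw [← e.sum_repr' x]
    rw [map_sum]
    refine Finset.sum_congr rfl fun i _ => ?_
    rw [map_smul, he, hA.apply_eigenvectorBasis hn i, smul_smul, mul_comm]
    rfl
  rw [hx, inner_sum]
  refine Finset.sum_congr rfl fun i _ => ?_
  rw [inner_smul_right, real_inner_comm, sq]
  ring

/-- **NORMAL-MODE GROUND STATE.**  For a symmetric operator `A` with eigenvalues `aᵢ ≥ 0` (eigenframe `eᵢ`), `b > 0`, and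
`cᵢ = √(aᵢ² + 2aᵢb)` (any `cᵢ ≥ 0` with `cᵢ² = aᵢ² + 2aᵢb`): the kernel `e^{−⟪x,Ax⟫} e^{−b‖x−y‖²} e^{−⟪y,Ay⟫}` reproduces the Gaussian
`h(x) = e^{−Σcᵢ⟪eᵢ,x⟫²}` with the factor `Πᵢ √(π/(aᵢ+b+cᵢ))` — the product of the one-mode transfer eigenvalues.
[cite: Wipf2021, §8.5.1 (8.56)–(8.57)] [cite: Wipf2021, §8.5.2 (8.64)–(8.67)] -/
theorem integral_gaussKernel_mul_groundState_symm (hA : A.IsSymmetric) (hn : Module.finrank ℝ V = n)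
    (hpos : ∀ i, 0 ≤ hA.eigenvalues hn i) {b : ℝ} (hb : 0 < b) {c : Fin n → ℝ} (hc0 : ∀ i, 0 ≤ c i)
    (hc : ∀ i, c i ^ 2 = hA.eigenvalues hn i ^ 2 + 2 * hA.eigenvalues hn i * b) (x : V) :
    ∫ y, Real.exp (-⟪x, A x⟫) * Real.exp (-(b * ‖x - y‖ ^ 2)) * Real.exp (-⟪y, A y⟫) *
        Real.exp (-(∑ i, c i * ⟪hA.eigenvectorBasis hn i, y⟫ ^ 2)) =
      (∏ i, Real.sqrt (π / (hA.eigenvalues hn i + b + c i))) *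
        Real.exp (-(∑ i, c i * ⟪hA.eigenvectorBasis hn i, x⟫ ^ 2)) := by
  simp_rw [inner_self_apply_eq_sum_eigenvalues hA hn]
  exact integral_gaussKernel_mul_groundState_frame (hA.eigenvectorBasis hn) hpos hb hc0 hc x

/-- **NORMAL-MODE FORM BOUND.**  For a symmetric `A` with eigenvalues `aᵢ ≥ 0`, `b > 0`, `cᵢ ≥ 0`, `cᵢ² = aᵢ² + 2aᵢb`, and `f` with `f²`
integrable: `∫∫ f(x) e^{−⟪x,Ax⟫} e^{−b‖x−y‖²} e^{−⟪y,Ay⟫} f(y) dy dx ≤ (Πᵢ √(π/(aᵢ+b+cᵢ))) ∫ f²` — the top of the spectrum of the harmonic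
transfer operator with Hessian `A` is the product of its normal-mode eigenvalues. [cite: Wipf2021, §8.5.1 (8.56)–(8.58)]
[cite: Wipf2021, §8.5.2 (8.64)–(8.67)] -/
theorem integral_integral_mul_gaussKernel_mul_self_le_symm (hA : A.IsSymmetric) (hn : Module.finrank ℝ V = n)
    (hpos : ∀ i, 0 ≤ hA.eigenvalues hn i) {b : ℝ} (hb : 0 < b) {c : Fin n → ℝ} (hc0 : ∀ i, 0 ≤ c i)
    (hc : ∀ i, c i ^ 2 = hA.eigenvalues hn i ^ 2 + 2 * hA.eigenvalues hn i * b) {f : V → ℝ}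
    (hf : Integrable (fun x => f x ^ 2)) (hfm : AEStronglyMeasurable f volume) :
    ∫ x, ∫ y, f x * (Real.exp (-⟪x, A x⟫) * Real.exp (-(b * ‖x - y‖ ^ 2)) * Real.exp (-⟪y, A y⟫)) * f y ≤
      (∏ i, Real.sqrt (π / (hA.eigenvalues hn i + b + c i))) * ∫ x, f x ^ 2 := by
  simp_rw [inner_self_apply_eq_sum_eigenvalues hA hn]
  exact integral_integral_mul_gaussKernel_mul_self_le_frame (hA.eigenvectorBasis hn) hpos hb hc0 hc hf hfm

omit [MeasurableSpace V] [BorelSpace V] in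
/-- The canonical choice `cᵢ = √(aᵢ² + 2aᵢb)` satisfies the hypotheses (`aᵢ, b ≥ 0`). [cite: Wipf2021, §8.5.1 (8.57)] -/
theorem sqrt_choice (hA : A.IsSymmetric) (hn : Module.finrank ℝ V = n) (hpos : ∀ i, 0 ≤ hA.eigenvalues hn i) {b : ℝ} (hb : 0 ≤ b)
    (i : Fin n) :
    0 ≤ Real.sqrt (hA.eigenvalues hn i ^ 2 + 2 * hA.eigenvalues hn i * b) ∧
      Real.sqrt (hA.eigenvalues hn i ^ 2 + 2 * hA.eigenvalues hn i * b) ^ 2 =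
        hA.eigenvalues hn i ^ 2 + 2 * hA.eigenvalues hn i * b :=
  ⟨Real.sqrt_nonneg _, sqrt_sq_eq (hpos i) hb⟩

end Symm

end Literature.Analysis.OperatorTheory.GaussianTransferKernel

end
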